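import Mathlib
import HarnessLib
import Summits.ValiantsHypothesis.ValiantsHypothesis.Theses.MonotoneRestoration
import Literature.Computability.AlgebraicComplexity.ArithCircuit
import Literature.Computability.AlgebraicComplexity.ArithCircuitProofs
import Literature.Computability.AlgebraicComplexity.MonotoneStructure
import Literature.Computability.AlgebraicComplexity.PermanentIrreducible
import Literature.ModelTheory.FiniteModelTheory.CkEquiv
import Summits.ValiantsHypothesis.ValiantsHypothesis.Theorems.MonotoneRestorationMonotoneRestorationQPCosetCount
import Summits.ValiantsHypothesis.ValiantsHypothesis.Theorems.MonotoneRestorationMonotoneRestorationQPSymmetricLB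
import Summits.ValiantsHypothesis.ValiantsHypothesis.Theorems.MonotoneRestorationMonotoneRestorationQPSupportSymmetrisation
import Summits.ValiantsHypothesis.ValiantsHypothesis.Theorems.MonotoneRestorationMonotoneRestorationQPSparseRegime
import Summits.ValiantsHypothesis.ValiantsHypothesis.Theorems.MonotoneRestorationMonotoneRestorationQPBeta
import Literature.Computability.AlgebraicComplexity.SymmetricArithCircuit
import Literature.Computability.AlgebraicComplexity.DawarWilsenach2025Proofs
import Literature.GroupTheory.PermutationGroups.SmallIndexSubgroups
import Summits.ValiantsHypothesis.ValiantsHypothesis.Theorems.MonotoneRestorationQP.Negative.LoadBearing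
import Summits.ValiantsHypothesis.ValiantsHypothesis.Theorems.MonotoneRestorationMonotoneRestorationQPPermSupportCount
import Literature.Computability.AlgebraicComplexity.ElementarySymmetricCircuit

/-! TTRL-lite variant V20262 of stmt-ValiantsHypothesis-15886

Target `stub_esymmRowSums_complexity`, move `specialise` (explicit library shape of the bound at
`d = ⌊n/2⌋`): the witness family `e_{⌊n/2⌋}(R_1, …, R_n)` (elementary symmetric polynomial of the
row sums `R_i = Σ_j x_{ij}` of an `n × n` matrix of variables) has, over `ℝ≥0` (hence by monotone
circuits), fan-in-two complexity at most `2 (⌊n/2⌋ + 1) n + n · n` — the dynamic programme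
(`2 (d+1) n`) plus reading the `n²` inputs into the row sums. This is literally the tree's
`complexity_esymm_rowSums_le` (`ElementarySymmetricCircuit.lean`) at `ι = κ = Fin n`,
`d = n / 2`, after `Fintype.card (Fin n) = n`. -/

-- `Summit.ValiantsHypothesis.ValiantsHypothesis.…` is the tree's mandated single-conjunct layout
-- (Sub = Summit), so the duplicated namespace component is intended.
set_option linter.dupNamespace false

namespace Summit.ValiantsHypothesis.ValiantsHypothesis.Theorems

open Summit.ValiantsHypothesis.ValiantsHypothesis.Theses.MonotoneRestoration
open Literature.Computability.AlgebraicComplexity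

/-- **TTRL-lite variant V20262 of `stub_esymmRowSums_complexity`** (stmt-ValiantsHypothesis-15886,
move `specialise`, explicit library shape at `d = ⌊n/2⌋`): for every `n`, the elementary symmetric
polynomial `e_{⌊n/2⌋}` of the row sums of an `n × n` matrix of variables, over `ℝ≥0`, has
fan-in-two complexity at most `2 (⌊n/2⌋ + 1) n + n · n`.
Specialisation of `complexity_esymm_rowSums_le` to `ι = κ = Fin n`, `d = n / 2`.
[cite: Burgisser2000, Rem. 2.7] -/
theorem stub_esymmRowSums_complexity_var20262 :
    ∀ n : ℕ, complexity (MvPolynomial.bind₁ (fun i : Fin n => ∑ j : Fin n, MvPolynomial.X (i, j))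
      (MvPolynomial.esymm (Fin n) NNReal (n / 2))) ≤ 2 * (n / 2 + 1) * n + n * n := by
  intro n
  simpa only [Fintype.card_fin] using
    complexity_esymm_rowSums_le (R := NNReal) (ι := Fin n) (κ := Fin n) (n / 2)

end Summit.ValiantsHypothesis.ValiantsHypothesis.Theorems
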